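import Mathlib

/-!
# SoloBlind — the filling bound for a curved third member over a subgroup pair (anchor of LieExponent §3.31)

Setting (pen side, `paper/LieExponent.md` §3.31): `(S; H₂, H₃)` a TPP triple in a real Lie group `G`,
`H₂, H₃` connected Lie subgroups with `𝔥₂ ∩ 𝔥₃ = 0`, `U₀ = 𝔥₂ ⊕ 𝔥₃` of codimension `m`, `V(s)` the
right-translated tangent space of `S` at a generic point, `W(s) = V(s) ∩ U₀`, `q(s) = codim (V(s) + U₀) ≥ 1`.
A subalgebra `𝔟` is PAIR-SPLIT if `𝔟 = (𝔟 ∩ 𝔥₂) ⊕ (𝔟 ∩ 𝔥₃)`.  The analytic input (Lemma 3.31, slicing by the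
cosets of `B = ⟨exp 𝔟⟩` plus Lemma 2.1 inside `B`) is `V(s) ∩ 𝔟 = 0` for generic `s`; everything after it is the
linear algebra and arithmetic checked here:

* `soloLie_coclosed_sup` — the source of pair-split subalgebras: if a Lie subalgebra `Z` CO-CLOSES with `H`
  (`⁅Z, H⁆ ⊆ Z + H`, e.g. `Z` normalises `H`), then `Z + H` is the carrier of a Lie subalgebra;
* `soloLie_filling_injection` — `W ⊓ 𝔟 = ⊥` with `W, 𝔟 ≤ U₀` gives `dim W + dim 𝔟 ≤ dim U₀`;
* `soloLie_filling_deficit` — the bookkeeping `d₁ = dim W + m − q`, hence `d₁ + q + β ≤ d` (Theorem 17), the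
  recovery of the Lie normaliser inequality (Lemma 3.14: `d₁ + a + h₃ ≤ d − 1`) and the saturation criterion
  `2β + 2m + 2q ≥ d + ι + 2 ⟹ d₁ ≤ N_G + m − 1` (conjecture (S₂) for the pair), with `d = 2 N_G + ι`;
* `soloLie_filling_torusStable` — the root count behind Corollary 17.2: for a pair of `𝔱`-stable subalgebras
  of a split reductive algebra (`h_j = a_j + |Φ_j|`, `Φ₂ ∩ Φ₃ = ∅ so |Φ₂| + |Φ₃| ≤ 2 N_G`) the filling bound with
  `𝔟 = 𝔱_j ⊕ 𝔥_k` gives `d₁ ≤ N_G + m − q`.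
-/

set_option linter.dupNamespace false

namespace Summit.MatrixMultiplication.MatrixMultiplication.Theorems

section LieAlgebra

variable {R L : Type*} [CommRing R] [LieRing L] [LieAlgebra R L]

/-- CO-CLOSING.  If `⁅z, h⁆ ∈ Z + H` for all `z ∈ Z`, `h ∈ H` (in particular if `Z` normalises `H`), then the
submodule `Z + H` is closed under the bracket, i.e. it is (the carrier of) a Lie subalgebra.  With `Z ≤ 𝔥₂` and
`Z ⊓ 𝔥₃ = ⊥`-type hypotheses this is how pair-split subalgebras `𝔟 = Z ⊕ 𝔥₃` arise (§3.31, Theorem 17(i)). -/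
theorem soloLie_coclosed_sup (Z H : LieSubalgebra R L)
    (hZ : ∀ z ∈ Z, ∀ h ∈ H, ⁅z, h⁆ ∈ Z.toSubmodule ⊔ H.toSubmodule) :
    ∃ B : LieSubalgebra R L, B.toSubmodule = Z.toSubmodule ⊔ H.toSubmodule := by
  refine ⟨⟨Z.toSubmodule ⊔ H.toSubmodule, ?_⟩, rfl⟩
  intro x y hx hy
  change x ∈ Z.toSubmodule ⊔ H.toSubmodule at hx
  change y ∈ Z.toSubmodule ⊔ H.toSubmodule at hy
  change ⁅x, y⁆ ∈ Z.toSubmodule ⊔ H.toSubmodule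
  obtain ⟨z, hz, h, hh, rfl⟩ := Submodule.mem_sup.1 hx
  obtain ⟨z', hz', h', hh', rfl⟩ := Submodule.mem_sup.1 hy
  have e : ⁅z + h, z' + h'⁆ = ⁅z, z'⁆ + ⁅z, h'⁆ + (⁅h, z'⁆ + ⁅h, h'⁆) := by
    simp only [add_lie, lie_add]
    abel
  rw [e]
  refine Submodule.add_mem _ (Submodule.add_mem _ ?_ ?_) (Submodule.add_mem _ ?_ ?_)
  · exact Submodule.mem_sup_left (Z.lie_mem hz hz')
  · exact hZ z hz h' hh'
  · have h1 : ⁅h, z'⁆ = -⁅z', h⁆ := (lie_skew _ _).symm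
    rw [h1]
    exact Submodule.neg_mem _ (hZ z' hz' h hh)
  · exact Submodule.mem_sup_right (H.lie_mem hh hh')

/-- The normalising case of co-closing: `⁅z, h⁆ ∈ H` for `z ∈ Z`, `h ∈ H` (i.e. `Z ≤ N(H)`). -/
theorem soloLie_normalizer_sup (Z H : LieSubalgebra R L)
    (hZ : ∀ z ∈ Z, ∀ h ∈ H, ⁅z, h⁆ ∈ H) :
    ∃ B : LieSubalgebra R L, B.toSubmodule = Z.toSubmodule ⊔ H.toSubmodule :=
  soloLie_coclosed_sup Z H fun z hz h hh => Submodule.mem_sup_right (hZ z hz h hh)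

end LieAlgebra

section LinearAlgebra

variable {K V : Type*} [Field K] [AddCommGroup V] [Module K V] [FiniteDimensional K V]

open Module

/-- FILLING INJECTION.  If `W ⊓ 𝔟 = ⊥` and both lie in `U₀`, then `dim W + dim 𝔟 ≤ dim U₀`
(`W ↪ U₀ / 𝔟`).  In §3.31: `W = V(s) ∩ U₀`, `𝔟` pair-split, `W ∩ 𝔟 ⊆ V(s) ∩ 𝔟 = 0` by Lemma 3.31. -/
theorem soloLie_filling_injection (W B U : Submodule K V) (hW : W ≤ U) (hB : B ≤ U)
    (hWB : W ⊓ B = ⊥) : finrank K W + finrank K B ≤ finrank K U := by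
  have h1 := Submodule.finrank_sup_add_finrank_inf_eq W B
  rw [hWB, finrank_bot, add_zero] at h1
  have h2 : finrank K ↥(W ⊔ B) ≤ finrank K U := Submodule.finrank_mono (sup_le hW hB)
  omega

omit [FiniteDimensional K V] in
/-- Monotonicity used for `W ∩ 𝔟 ⊆ V ∩ 𝔟 = 0`: if `W ≤ V` and `V ⊓ B = ⊥` then `W ⊓ B = ⊥`. -/
theorem soloLie_inf_eq_bot_of_le (W V' B : Submodule K V) (hW : W ≤ V') (hVB : V' ⊓ B = ⊥) :
    W ⊓ B = ⊥ :=
  le_bot_iff.1 (le_trans (inf_le_inf_right B hW) (le_of_eq hVB))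

end LinearAlgebra

section Bookkeeping

/-- THEOREM 17 BOOKKEEPING.  Naturals: `d = dim G = 2N + ι` (`N = N_G`), pair codimension `m`
(`h₂ + h₃ + m = d`), `d₁ = dim S`, `w = dim W(s)`, `q = q(s)`, `β = dim 𝔟` for a pair-split `𝔟`.
Hypotheses: `d₁ + q = w + m` (`dim V = dim W + dim(V+U₀) − dim U₀`), `w + β + m ≤ d` (filling injection into
`U₀`, `dim U₀ = d − m`).  Conclusions: (1) `d₁ + q + β ≤ d`; (2) with `β = a + h₃` (`𝔟 = 𝔞 ⊕ 𝔥₃`, `𝔞 ≤ 𝔥₂`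
normalising or co-closing with `𝔥₃`) and `q ≥ 1`: `d₁ + a + h₃ + 1 ≤ d` — the Lie normaliser inequality 3.14;
(3) saturation: if `2β + 2m + 2q ≥ d + ι + 2` then `2 d₁ + ι + 2 ≤ d + 2m`, i.e. `d₁ ≤ N + m − 1` ((S₂));
(4) in general the deficit `δ = d/2 + m − d₁` obeys `2δ = d + 2m − 2d₁ ≥ 2β + 2m + 2q − d`. -/
theorem soloLie_filling_deficit (d ι N m q w β d₁ a h₂ h₃ : ℕ)
    (hd : d = 2 * N + ι) (hm : h₂ + h₃ + m = d) (hq : 1 ≤ q)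
    (hV : d₁ + q = w + m) (hinj : w + β + m ≤ d) :
    (d₁ + q + β ≤ d) ∧
    (β = a + h₃ → d₁ + a + h₃ + 1 ≤ d) ∧
    (d + ι + 2 ≤ 2 * β + 2 * m + 2 * q → 2 * d₁ + ι + 2 ≤ d + 2 * m) ∧
    (2 * β + 2 * m + 2 * q ≤ d + (d + 2 * m - 2 * d₁)) := by
  refine ⟨by omega, fun hβ => by omega, fun hS => by omega, by omega⟩

/-- COROLLARY 17.2 ROOT COUNT (torus-stable pairs in a split reductive algebra).  `h_j = a_j + Φ_j`
(`a_j = dim (𝔥_j ∩ 𝔱)`, `Φ_j` = number of root spaces in `𝔥_j`), `Φ₂ + Φ₃ ≤ 2N` (disjoint root sets),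
`𝔟 = 𝔱_j ⊕ 𝔥_k` is pair-split of dimension `a_j + h_k` for BOTH `j`, so Theorem 17 gives
`d₁ + q + a₂ + h₃ ≤ d` and `d₁ + q + a₃ + h₂ ≤ d`; conclusion `d₁ + q ≤ N + m`, i.e. (S₂) with one to spare
when `q ≥ 2`. -/
theorem soloLie_filling_torusStable (d N ι m q d₁ a₂ a₃ Φ₂ Φ₃ h₂ h₃ : ℕ)
    (hd : d = 2 * N + ι) (hm : h₂ + h₃ + m = d) (h2 : h₂ = a₂ + Φ₂) (h3 : h₃ = a₃ + Φ₃)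
    (hΦ : Φ₂ + Φ₃ ≤ 2 * N)
    (hfill₂ : d₁ + q + (a₂ + h₃) ≤ d) (hfill₃ : d₁ + q + (a₃ + h₂) ≤ d) :
    d₁ + q ≤ N + m := by
  omega

/-- COROLLARY 17.1 (normaliser of Borel size).  If `dim 𝔫(𝔥₃) = ν` then `dim (𝔥₂ ∩ 𝔫(𝔥₃)) ≥ h₂ + ν − d`
(linear algebra), the pair-split `𝔟 = (𝔥₂ ∩ 𝔫(𝔥₃)) ⊕ 𝔥₃` has `β ≥ h₂ + h₃ + ν − d = ν − m`, and Theorem 17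
gives `d₁ + q + ν ≤ d + m`; so `ν ≥ (d + ι)/2 − (q − 1)` (a normaliser of at least Borel dimension when
`q = 1`) forces `d₁ ≤ N + m − 1`. -/
theorem soloLie_filling_normalizer (d N ι m q d₁ h₂ h₃ ν z β : ℕ)
    (hd : d = 2 * N + ι) (hm : h₂ + h₃ + m = d)
    (hz : h₂ + ν ≤ z + d) (hβ : β = z + h₃) (hfill : d₁ + q + β ≤ d)
    (hν : d + ι + 2 ≤ 2 * ν + 2 * q) :
    2 * d₁ + ι + 2 ≤ d + 2 * m := by
  omega

end Bookkeeping

end Summit.MatrixMultiplication.MatrixMultiplication.Theorems
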